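import Mathlib
import Literature.Analysis.FluidPDE.VectorCalculus
import Literature.Analysis.FluidPDE.VortexFilament.CurlEnergy
import Summits.NavierStokesRegularity.NavierStokesRegularity.Theorems.FilamentSkeletonRssSelectionBoxRJRungStraightSkewTools

/-!
# Route `FilamentSkeletonRss` · crux `SelectionBoxRJ` (stmt-NavierStokesRegularity-21220) — rung tools (R1):
# constants bookkeeping of the model rung and the `R_π` geometry of the straight pair

Lane `ns-filament-19175-p1` (g7); helper file `--supports stmt-NavierStokesRegularity-21220`, route-independent.  Consumed by
`…RungModelArc.lean`:
* `norm_rotPi` — the rotation by `π` about `e₃`, written `y ↦ 2⟪y, e₃⟫e₃ − y`, is an isometry;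
* `norm_sq_line_sub_rot` — `‖ℓ τ − R_π ℓ σ‖² = 4Γ/25 + τ² + σ²` for the rung-0 line `ℓ t = (√Γ/5, 0, 0) + t e` (the skew
  pair's closest approach is the waist separation `(2/5)√Γ`);
* `rung_constants` — for `0 < Rb ≤ 1/200`, `Γ ≥ exp(Rb⁻²)`, `0 < η ≤ 7/(Γ log Γ)`: `Γ ≥ 10⁴`, and the near-straightness and
  curvature budgets `M₂ S₂ ≤ 1/500`, `M₂ √Γ ≤ 1` of the cut-off arc (`S₂ = (6/5)Rb√(Γ log Γ)`,
  `M₂ = η((47/10)(√Γ/5 + S₂) + (8/5)√Γ)`), Γ-uniformly — the `σ`-scaling of `SIGMA-SCALING-21220.md` in inequalities.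

HONEST FRAMING.  Elementary inequalities for the MODEL rung of a HYPOTHETICAL filament box; nothing here is a claim about
Navier–Stokes regularity or blow-up.
-/

set_option linter.dupNamespace false -- `Theorems.…Theorems`-style path/namespace repetition is the tree convention

noncomputable section

namespace Summit.NavierStokesRegularity.NavierStokesRegularity.Theorems

open Set Function Filter Real
open Literature.Analysis.FluidPDE
open scoped InnerProductSpace Topology

namespace SelectionBoxRJRung

/-- `‖2⟪v, e₃⟫ e₃ − v‖ = ‖v‖`: the rotation by `π` about `e₃` is an isometry. [folklore] -/
theorem norm_rotPi (v : EuclideanSpace ℝ (Fin 3)) :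
    ‖(2 * ⟪v, EuclideanSpace.single 2 1⟫_ℝ) • (EuclideanSpace.single (2 : Fin 3) (1 : ℝ)) - v‖ = ‖v‖ := by
  have he3 : ‖(EuclideanSpace.single (2 : Fin 3) (1 : ℝ) : EuclideanSpace ℝ (Fin 3))‖ = 1 := by simp
  have hsq : ‖(2 * ⟪v, EuclideanSpace.single 2 1⟫_ℝ) • (EuclideanSpace.single (2 : Fin 3) (1 : ℝ)) - v‖ ^ 2 = ‖v‖ ^ 2 := by
    rw [norm_sub_sq_real, norm_smul, he3, mul_one, inner_smul_left, Real.norm_eq_abs, sq_abs,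
      real_inner_comm]
    simp only [conj_trivial]
    ring
  nlinarith [norm_nonneg ((2 * ⟪v, EuclideanSpace.single 2 1⟫_ℝ) • (EuclideanSpace.single (2 : Fin 3) (1 : ℝ)) - v),
    norm_nonneg v, hsq, sq_nonneg (‖(2 * ⟪v, EuclideanSpace.single 2 1⟫_ℝ) • (EuclideanSpace.single (2 : Fin 3) (1 : ℝ)) - v‖ - ‖v‖)]

/-- The rotated rung-0 line seen from the rung-0 line: `‖ℓ τ − R_π ℓ σ‖² = 4Γ/25 + τ² + σ²` (`Γ ≥ 0`). [folklore] -/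
theorem norm_sq_line_sub_rot (Γ τ σ : ℝ) (hΓ : 0 ≤ Γ) :
    ‖((WithLp.toLp 2 ![Real.sqrt Γ / 5, 0, 0] : EuclideanSpace ℝ (Fin 3)) +
        τ • WithLp.toLp 2 ![0, (Real.sqrt 2)⁻¹, (Real.sqrt 2)⁻¹]) -
      ((2 * ⟪(WithLp.toLp 2 ![Real.sqrt Γ / 5, 0, 0] : EuclideanSpace ℝ (Fin 3)) +
          σ • WithLp.toLp 2 ![0, (Real.sqrt 2)⁻¹, (Real.sqrt 2)⁻¹], EuclideanSpace.single 2 1⟫_ℝ) •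
          (EuclideanSpace.single (2 : Fin 3) (1 : ℝ)) -
        ((WithLp.toLp 2 ![Real.sqrt Γ / 5, 0, 0] : EuclideanSpace ℝ (Fin 3)) +
          σ • WithLp.toLp 2 ![0, (Real.sqrt 2)⁻¹, (Real.sqrt 2)⁻¹]))‖ ^ 2 = 4 * Γ / 25 + τ ^ 2 + σ ^ 2 := by
  rw [pt₁, pt₁, single_two_eq_vec3, inner_vec3, smul_vec3, sub_vec3, sub_vec3, VortexFilament.norm_sq_toLp_three]
  have hs := inv_sqrt_two_mul_self
  have hG : Real.sqrt Γ * Real.sqrt Γ = Γ := Real.mul_self_sqrt hΓ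
  simp only [mul_zero, mul_one, zero_sub]
  linear_combination (2 * τ ^ 2 + 2 * σ ^ 2) * hs + (4 / 25) * hG

/-- **Bookkeeping of the constants.**  For `0 < Rb ≤ 1/200`, `Γ ≥ exp(Rb⁻²)`, `0 < η ≤ 7/(Γ log Γ)`: `Γ ≥ 10⁴`, the ball
parameter `S = Rb√(Γ log Γ)` is positive, and with the cut-off radius `S₂ = (6/5)S` and the curvature scale
`M₂ = η((47/10)(√Γ/5 + S₂) + (8/5)√Γ)` one has `M₂ S₂ ≤ 1/500` (near-straightness budget) and `M₂ √Γ ≤ 1` (curvature budget):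
`η√Γ S₂ ≤ (42/5)Rb²`, `η S₂² ≤ (252/25)Rb²`, `η Γ ≤ 7Rb²` from `η Γ log Γ ≤ 7` and `√(log Γ) ≥ 1/Rb`. [folklore] -/
theorem rung_constants {Γ Rb η : ℝ} (hRb0 : 0 < Rb) (hRb : Rb ≤ 1 / 200) (hΓ : Real.exp (1 / Rb ^ 2) ≤ Γ)
    (hη0 : 0 < η) (hη : η * (Γ * Real.log Γ) ≤ 7) :
    (10 : ℝ) ^ 4 ≤ Γ ∧ 0 < Rb * Real.sqrt (Γ * Real.log Γ) ∧
    η * ((47 / 10) * (Real.sqrt Γ / 5 + 6 / 5 * (Rb * Real.sqrt (Γ * Real.log Γ))) + 8 / 5 * Real.sqrt Γ) *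
        (6 / 5 * (Rb * Real.sqrt (Γ * Real.log Γ))) ≤ 1 / 500 ∧
    η * ((47 / 10) * (Real.sqrt Γ / 5 + 6 / 5 * (Rb * Real.sqrt (Γ * Real.log Γ))) + 8 / 5 * Real.sqrt Γ) *
        Real.sqrt Γ ≤ 1 := by
  have hRb2 : 40000 ≤ 1 / Rb ^ 2 := by
    rw [le_div_iff₀ (by positivity)]; nlinarith
  have hexp : 1 / Rb ^ 2 + 1 ≤ Real.exp (1 / Rb ^ 2) := Real.add_one_le_exp _
  have hΓ4 : (10 : ℝ) ^ 4 ≤ Γ := by linarith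
  have hΓ0 : 0 < Γ := by linarith
  set G : ℝ := Real.sqrt Γ with hGdef
  have hG : 0 < G := Real.sqrt_pos.2 hΓ0
  have hG2 : G ^ 2 = Γ := Real.sq_sqrt hΓ0.le
  set L : ℝ := Real.log Γ with hLdef
  have hL : 1 / Rb ^ 2 ≤ L := by
    have := Real.log_le_log (Real.exp_pos _) hΓ
    rwa [Real.log_exp] at this
  have hL0 : 0 < L := lt_of_lt_of_le (by positivity) hL
  set M : ℝ := Real.sqrt L with hMdef
  have hM : 0 < M := Real.sqrt_pos.2 hL0
  have hM2 : M ^ 2 = L := Real.sq_sqrt hL0.le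
  have hRbM : 1 ≤ Rb * M := by
    have h1 : 1 / Rb ≤ M := by
      rw [hMdef, ← Real.sqrt_sq (by positivity : (0:ℝ) ≤ 1 / Rb)]
      exact Real.sqrt_le_sqrt (by rw [div_pow, one_pow]; exact hL)
    have := mul_le_mul_of_nonneg_left h1 hRb0.le
    rwa [mul_one_div_cancel hRb0.ne'] at this
  have hGM : Real.sqrt (Γ * Real.log Γ) = G * M := by
    rw [hGdef, hMdef, hLdef, Real.sqrt_mul hΓ0.le]
  rw [hGM]
  have hK : η * G ^ 2 * M ^ 2 ≤ 7 := by rw [hG2, hM2]; simpa [mul_assoc] using hη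
  have hηG2 : η * G ^ 2 ≤ 7 * Rb ^ 2 := by
    have h1 : η * G ^ 2 ≤ η * G ^ 2 * (Rb * M) ^ 2 := by
      have : (1:ℝ) ≤ (Rb * M) ^ 2 := by nlinarith
      nlinarith [mul_pos hη0 (pow_pos hG 2)]
    nlinarith [h1, hK, sq_nonneg Rb]
  have hηGM : η * G ^ 2 * M ≤ 7 * Rb := by
    have h1 : η * G ^ 2 * M ≤ η * G ^ 2 * M * (Rb * M) := by
      have := mul_pos (mul_pos hη0 (pow_pos hG 2)) hM
      nlinarith
    nlinarith [h1, hK, hRb0]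
  set S₂ : ℝ := 6 / 5 * (Rb * (G * M)) with hS₂def
  have hA : η * G * S₂ ≤ 42 / 5 * Rb ^ 2 := by
    have : η * G * S₂ = 6 / 5 * Rb * (η * G ^ 2 * M) := by rw [hS₂def]; ring
    rw [this]; nlinarith [hηGM, hRb0]
  have hB : η * S₂ ^ 2 ≤ 252 / 25 * Rb ^ 2 := by
    have : η * S₂ ^ 2 = 36 / 25 * Rb ^ 2 * (η * G ^ 2 * M ^ 2) := by rw [hS₂def]; ring
    rw [this]; nlinarith [hK, sq_nonneg Rb]
  refine ⟨hΓ4, by positivity, ?_, ?_⟩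
  · have : η * ((47 / 10) * (G / 5 + S₂) + 8 / 5 * G) * S₂ = 127 / 50 * (η * G * S₂) + 47 / 10 * (η * S₂ ^ 2) := by ring
    rw [this]; nlinarith [hA, hB]
  · have : η * ((47 / 10) * (G / 5 + S₂) + 8 / 5 * G) * G = 127 / 50 * (η * G ^ 2) + 47 / 10 * (η * G * S₂) := by ring
    rw [this]; nlinarith [hηG2, hA]

end SelectionBoxRJRung

end Summit.NavierStokesRegularity.NavierStokesRegularity.Theorems
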